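import Summits.AtomisticToContinuum.Crystallization.Theorems.FrustratedLawDichotomyStrainedPatchHomCurvLJLeaf
import Summits.AtomisticToContinuum.Crystallization.Theorems.FrustratedLawDichotomyStrainedPatchHomForceJacN

/-!
# NEAR/FAR composition of the LJ7 force-Jacobian certificate: centred `curvCheckLJ` on the near labels + sqrt-free naive `forceJacCheckN` on the far
# labels ⟹ the exterior force bound / slab confinement `T″` on the union (hand-2 g29 gate K-file finding, critic rows 1089/1097/1099/1102)

decomp-a2c hand-2 g29 (crux `AperiodicFrustratedLawGap`, stmt-AtomisticToContinuum-27623).  KERNEL FINDING of this generation: hand-1's centred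
certificate `…HomCurvLJLeaf.curvCheckLJ` passes the gate (`c_λ(2⁻¹¹) ≥ 0.85`, 82–113 s) on the labels that carry the curvature (`ρ ≤ 4.7 … 5.5`) but
collapses (not even PSD) once labels with `ρ ≳ 6` are put through its tube/`naiveLJ` enclosures, while the sqrt-free enclosures of `…HomForceJacN`
(`vecB → dot3 → ljTripleFI / phiFI`) stay sane on all `1154` labels within `7.25`.  Mathematically the far labels are a FIRST-ORDER matter
(`Σ_{4.7<ρ≤7.25} ‖h_b‖ ≈ 6·10⁻³ ≪ λ ≈ 7`).  This file composes the two landed Booleans additively — curvature sums over disjoint label families ADD: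

* `segGd_sum_eq_hessForm` — the far family's Hessian-form floor of `forceJac_floor_of_checkN` in `segGd` currency (`…HomForceRingLJ.segGd_ljProfile_hcp`);
* ★★ `jac_floor_of_two_checks` — `curvCheckLJ c w Lc Ln lam₁` (near: `Lc ++ Ln`) ∧ `forceJacCheckN c w Lf lam₂` (far, `lam₂` may be NEGATIVE: a
  Jacobian-norm debit) ∧ pairwise disjointness ⟹ `((lam₁ + lam₂)/SC)·‖U(ξ−ξ₀)‖² ≤ Σ_{b ∈ Lc ++ Ln ++ Lf} segGd W₁ p_b Δ s`;
* ★★★ `hcpForceLJ_exterior_of_two_checks` / `hcpForceLJ_slab_of_two_checks` — via `…HomForceRing.hcpForceLJ_exterior` / `_slab_confinement`.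

NO definitions; 0 sorry; standard axioms; no instances / notation / `#eval`.  `--supports stmt-AtomisticToContinuum-27623`.
-/

noncomputable section

namespace Summit.AtomisticToContinuum.Crystallization.Theorems.FrustratedLawDichotomyStrainedPatchHomForceJacN

open scoped BigOperators RealInnerProductSpace
open Literature.Analysis.ValidatedNumerics.Numerics
open Summit.AtomisticToContinuum.Crystallization.Theorems.ChargedEnergyGapNegative (E3)
open Summit.AtomisticToContinuum.Crystallization.Theorems.FrustratedLawDichotomyStrainedPatchHomSplit (latPt hexFrame hcpShift)
open Summit.AtomisticToContinuum.Crystallization.Theorems.FrustratedLawDichotomyStrainedPatchTaylorChord (segGd)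
open Summit.AtomisticToContinuum.Crystallization.Theorems.FrustratedLawDichotomyStrainedPatchHomCurvRegime3 (alphaLJ betaLJ)
open Summit.AtomisticToContinuum.Crystallization.Theorems.FrustratedLawDichotomyStrainedPatchHomCurvLJ (curvCheckLJ curvLJ_floor_of_check)
open Summit.AtomisticToContinuum.Crystallization.Theorems.FrustratedLawDichotomyStrainedPatchHomForceRing
  (segGd_ljProfile_hcp hcpForceLJ_exterior hcpForceLJ_slab_confinement)

/-- The far family's Hessian-form floor in `segGd` currency. [formal bookkeeping] -/
theorem segGd_sum_eq_hessForm (S : Finset (Fin 3 → ℤ)) {U : E3 →L[ℝ] E3} (hU : ‖U - 1‖ ≤ 1 / 4) {ξ₀ ξ : E3} (hξ₀ : ‖ξ₀‖ ≤ 1 / 4)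
    (hξ : ‖ξ‖ ≤ 1 / 4) {s : ℝ} (hs : s ∈ Set.Icc (0 : ℝ) 1) :
    ∑ bb ∈ S, segGd (fun x : ℝ => x⁻¹ ^ 7 - x⁻¹ ^ 13) (latPt U hexFrame bb + U (hcpShift + ξ₀)) (U (ξ - ξ₀)) s =
      ∑ bb ∈ S, (alphaLJ ‖latPt U hexFrame bb + U (hcpShift + ξ₀) + s • U (ξ - ξ₀)‖ *
          ⟪latPt U hexFrame bb + U (hcpShift + ξ₀) + s • U (ξ - ξ₀), U (ξ - ξ₀)⟫ ^ 2 +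
        betaLJ ‖latPt U hexFrame bb + U (hcpShift + ξ₀) + s • U (ξ - ξ₀)‖ * ‖U (ξ - ξ₀)‖ ^ 2) :=
  Finset.sum_congr rfl fun bb _ => segGd_ljProfile_hcp hU hξ₀ hξ bb hs

/-- ★★ **THE JACOBIAN FLOOR OF THE UNION FROM TWO BOOLEANS**: centred `curvCheckLJ` on `Lc ++ Ln` with floor `lam₁` and sqrt-free naive
`forceJacCheckN` on `Lf` with floor `lam₂` (possibly negative), the three lists pairwise disjoint (`(Lc ++ Ln) ++ Lf` duplicate-free), give the floor
`(lam₁ + lam₂)/SC` for the curvature sum over `(Lc ++ Ln) ++ Lf` along the whole segment. [folklore: curvature sums add over disjoint label families] -/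
theorem jac_floor_of_two_checks {c w : (Fin 3 × Fin 3) ⊕ Fin 3 → ℤ} {Lc Ln Lf : List (Fin 3 → ℤ)} (hL : ((Lc ++ Ln) ++ Lf).Nodup) {lam₁ lam₂ : ℤ}
    (h₁ : curvCheckLJ c w Lc Ln lam₁ = true) (h₂ : forceJacCheckN c w Lf lam₂ = true) (U : E3 →L[ℝ] E3) (hU : ‖U - 1‖ ≤ 1 / 4)
    (hbox : ∀ ab : Fin 3 × Fin 3, |(U (EuclideanSpace.single ab.2 (1 : ℝ))) ab.1 - (c (Sum.inl ab) : ℝ) / SC| ≤ (w (Sum.inl ab) : ℝ) / SC)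
    (ξ₀ ξ : E3) (hξ₀ : ∀ i : Fin 3, |ξ₀ i - (c (Sum.inr i) : ℝ) / SC| ≤ (w (Sum.inr i) : ℝ) / SC)
    (hξ : ∀ i : Fin 3, |ξ i - (c (Sum.inr i) : ℝ) / SC| ≤ (w (Sum.inr i) : ℝ) / SC) (hn₀ : ‖ξ₀‖ ≤ 1 / 4) (hn : ‖ξ‖ ≤ 1 / 4)
    {s : ℝ} (hs : s ∈ Set.Ioo (0 : ℝ) 1) :
    ((lam₁ + lam₂ : ℤ) : ℝ) / SC * ‖U (ξ - ξ₀)‖ ^ 2 ≤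
      ∑ b ∈ ((Lc ++ Ln) ++ Lf).toFinset, segGd (fun x : ℝ => x⁻¹ ^ 7 - x⁻¹ ^ 13) (latPt U hexFrame b + U (hcpShift + ξ₀)) (U (ξ - ξ₀)) s := by
  classical
  obtain ⟨hL1, hLf, hdisj⟩ := List.nodup_append.1 hL
  have hdisj' : List.Disjoint (Lc ++ Ln) Lf := fun a ha hb => hdisj a ha a hb rfl
  have k₁ := curvLJ_floor_of_check hL1 h₁ U hU hbox ξ₀ ξ hξ₀ hξ hn₀ hn hs
  have k₂ := forceJac_floor_of_checkN hLf h₂ U hbox ξ₀ ξ hξ₀ hξ hs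
  rw [← segGd_sum_eq_hessForm Lf.toFinset hU hn₀ hn (Set.Ioo_subset_Icc_self hs)] at k₂
  rw [List.toFinset_append, Finset.sum_union (List.disjoint_toFinset_iff_disjoint.2 hdisj')]
  push_cast
  rw [add_div, add_mul]
  exact add_le_add k₁ k₂

/-- ★★★ **EXTERIOR FORCE BOUND FROM THE TWO BOOLEANS** (reference bound `f₀` at `ξ₀` over the union of labels):
`(((lam₁+lam₂)/SC)‖Δ‖ − f₀)‖Δ‖ ≤ Σ_{b ∈ Lc++Ln++Lf} (‖X_b‖⁻⁸ − ‖X_b‖⁻¹⁴)⟪X_b, Δ⟫`, `Δ = U(ξ−ξ₀)`, `X_b = latPt U hexFrame b + U(hcpShift+ξ)`. [folklore chaining] -/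
theorem hcpForceLJ_exterior_of_two_checks {c w : (Fin 3 × Fin 3) ⊕ Fin 3 → ℤ} {Lc Ln Lf : List (Fin 3 → ℤ)} (hL : ((Lc ++ Ln) ++ Lf).Nodup)
    {lam₁ lam₂ : ℤ} (h₁ : curvCheckLJ c w Lc Ln lam₁ = true) (h₂ : forceJacCheckN c w Lf lam₂ = true) {U : E3 →L[ℝ] E3} (hU : ‖U - 1‖ ≤ 1 / 4)
    (hbox : ∀ ab : Fin 3 × Fin 3, |(U (EuclideanSpace.single ab.2 (1 : ℝ))) ab.1 - (c (Sum.inl ab) : ℝ) / SC| ≤ (w (Sum.inl ab) : ℝ) / SC)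
    {ξ₀ ξ : E3} (hξ₀ : ∀ i : Fin 3, |ξ₀ i - (c (Sum.inr i) : ℝ) / SC| ≤ (w (Sum.inr i) : ℝ) / SC)
    (hξ : ∀ i : Fin 3, |ξ i - (c (Sum.inr i) : ℝ) / SC| ≤ (w (Sum.inr i) : ℝ) / SC) (hn₀ : ‖ξ₀‖ ≤ 1 / 4) (hn : ‖ξ‖ ≤ 1 / 4) {f₀ : ℝ}
    (hf₀ : |∑ bb ∈ ((Lc ++ Ln) ++ Lf).toFinset,
        (‖latPt U hexFrame bb + U (hcpShift + ξ₀)‖⁻¹ ^ 8 - ‖latPt U hexFrame bb + U (hcpShift + ξ₀)‖⁻¹ ^ 14) *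
          ⟪latPt U hexFrame bb + U (hcpShift + ξ₀), U (ξ - ξ₀)⟫| ≤ f₀ * ‖U (ξ - ξ₀)‖) :
    (((lam₁ + lam₂ : ℤ) : ℝ) / SC * ‖U (ξ - ξ₀)‖ - f₀) * ‖U (ξ - ξ₀)‖ ≤
      ∑ bb ∈ ((Lc ++ Ln) ++ Lf).toFinset,
        (‖latPt U hexFrame bb + U (hcpShift + ξ)‖⁻¹ ^ 8 - ‖latPt U hexFrame bb + U (hcpShift + ξ)‖⁻¹ ^ 14) *
          ⟪latPt U hexFrame bb + U (hcpShift + ξ), U (ξ - ξ₀)⟫ :=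
  hcpForceLJ_exterior _ hU hn₀ hn (fun _ hs => jac_floor_of_two_checks hL h₁ h₂ U hU hbox ξ₀ ξ hξ₀ hξ hn₀ hn hs) hf₀

/-- ★★★ **SLAB CONFINEMENT `T″` FROM THE TWO BOOLEANS**. [folklore chaining] -/
theorem hcpForceLJ_slab_of_two_checks {c w : (Fin 3 × Fin 3) ⊕ Fin 3 → ℤ} {Lc Ln Lf : List (Fin 3 → ℤ)} (hL : ((Lc ++ Ln) ++ Lf).Nodup)
    {lam₁ lam₂ : ℤ} (h₁ : curvCheckLJ c w Lc Ln lam₁ = true) (h₂ : forceJacCheckN c w Lf lam₂ = true) {U : E3 →L[ℝ] E3} (hU : ‖U - 1‖ ≤ 1 / 4)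
    (hbox : ∀ ab : Fin 3 × Fin 3, |(U (EuclideanSpace.single ab.2 (1 : ℝ))) ab.1 - (c (Sum.inl ab) : ℝ) / SC| ≤ (w (Sum.inl ab) : ℝ) / SC)
    {ξ₀ ξ : E3} (hξ₀ : ∀ i : Fin 3, |ξ₀ i - (c (Sum.inr i) : ℝ) / SC| ≤ (w (Sum.inr i) : ℝ) / SC)
    (hξ : ∀ i : Fin 3, |ξ i - (c (Sum.inr i) : ℝ) / SC| ≤ (w (Sum.inr i) : ℝ) / SC) (hn₀ : ‖ξ₀‖ ≤ 1 / 4) (hn : ‖ξ‖ ≤ 1 / 4)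
    (hΔ : U (ξ - ξ₀) ≠ 0) {f₀ σ : ℝ}
    (hf₀ : |∑ bb ∈ ((Lc ++ Ln) ++ Lf).toFinset,
        (‖latPt U hexFrame bb + U (hcpShift + ξ₀)‖⁻¹ ^ 8 - ‖latPt U hexFrame bb + U (hcpShift + ξ₀)‖⁻¹ ^ 14) *
          ⟪latPt U hexFrame bb + U (hcpShift + ξ₀), U (ξ - ξ₀)⟫| ≤ f₀ * ‖U (ξ - ξ₀)‖)
    (hσ : ∑ bb ∈ ((Lc ++ Ln) ++ Lf).toFinset,
        (‖latPt U hexFrame bb + U (hcpShift + ξ)‖⁻¹ ^ 8 - ‖latPt U hexFrame bb + U (hcpShift + ξ)‖⁻¹ ^ 14) *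
          ⟪latPt U hexFrame bb + U (hcpShift + ξ), U (ξ - ξ₀)⟫ ≤ σ * ‖U (ξ - ξ₀)‖) :
    ((lam₁ + lam₂ : ℤ) : ℝ) / SC * ‖U (ξ - ξ₀)‖ ≤ σ + f₀ ∧
      (0 ≤ ((lam₁ + lam₂ : ℤ) : ℝ) / SC → ((lam₁ + lam₂ : ℤ) : ℝ) / SC * (3 / 4 * ‖ξ - ξ₀‖) ≤ σ + f₀) :=
  hcpForceLJ_slab_confinement _ hU hn₀ hn hΔ (fun _ hs => jac_floor_of_two_checks hL h₁ h₂ U hU hbox ξ₀ ξ hξ₀ hξ hn₀ hn hs) hf₀ hσ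

end Summit.AtomisticToContinuum.Crystallization.Theorems.FrustratedLawDichotomyStrainedPatchHomForceJacN

end
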